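import Mathlib.Analysis.SpecialFunctions.Pow.Asymptotics
import Mathlib.Analysis.SpecialFunctions.Pow.Real
import Mathlib.Analysis.SpecialFunctions.Log.Basic
import Mathlib.Data.Nat.Choose.Basic
import Mathlib.Order.Filter.AtTopBot.Basic
import HarnessLib

/-!
# Roy's small value estimate for `𝔾ₐ × 𝔾ₘ` — the "for `D` large enough" thresholds of §7

Topic `Literature/NumberTheory/Transcendental`. Part of the formalisation of the proof of Roy 2013,
Theorem 1.1 (named fact `roy2013_thm_1_1`, `RoySmallValueEstimates.lean`), seat B. Source: D. Roy,
*A small value estimate for `𝔾ₐ × 𝔾ₘ`*, Mathematika 59 (2013) 333–363 = arXiv:1301.0663, §7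
(pp. 18–19), where every step holds "for `D` sufficiently large", e.g.

> `‖Q‖ ≤ D^j 𝓛(P̃_D) ≤ (D+1)^{2D^τ+1} exp(D^β) = exp((1+o(1))D^β)` [...]
> `≤ ∑_{α∈Z} log|I|_α + 7T(log T)² deg(Z) ≤ −(D^δ/25)(D^β deg(Z) + D h(Z))` if `D` is large
> enough (because `β > τ ≥ 1`) [...] For `D` large enough, we also have
> `⌊(D*+1)^τ⌋ ≤ binom(D*+2, 2)` [...]

This file collects the elementary real-analysis thresholds behind these "o(1)"s, as
`∀ᶠ D : ℕ in atTop` statements with symbolic exponents (`T = ⌊D^τ⌋`):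

* `eventually_log_mul_rpow_le_rpow`, `eventually_log_sq_mul_rpow_le_rpow` — `c (log D) D^a ≤ D^b`
  and `c (log D)² D^a ≤ D^b` for `a < b` (from Mathlib's `isLittleO_log_rpow_rpow_atTop`);
* `natFloor_rpow_le`, `rpow_le_two_mul_natFloor`, `one_le_natFloor_rpow` — `T ≤ D^τ ≤ 2T`, `T ≥ 1`;
* `tendsto_natFloor_rpow_atTop` — `T → ∞` (`τ > 0`);
* `eventually_mul_natFloor_rpow_le_choose` — `c ⌊D^τ⌋ ≤ binom(D+1, 2)` for `τ < 2`;
* `eventually_natFloor_log_sq_le` — `c T (log T)² ≤ D^b` for `τ < b` (the term `7T(log T)² deg Z`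
  of Step 2 against `D^{δ+β} deg Z / 25`).

Everything is proved; no definitions, no named facts.

## References

* [Roy2013] D. Roy, *A small value estimate for 𝔾ₐ × 𝔾ₘ*, Mathematika 59 (2013), 333–363
  (arXiv:1301.0663), §7, Steps 1–4 (the largeness conditions on `D`).
-/

noncomputable section

open Filter Real

namespace Literature.NumberTheory.Transcendental

namespace Roy2013

/-! ### Logarithms against powers -/

/-- `c D^a ≤ D^b` for large `D`, when `a < b` (as in the tree's
`NguyenRoy.EndgameData.eventually_mul_rpow_le_rpow`, restated here to keep the imports light).
[folklore] -/
theorem eventually_const_mul_rpow_le_rpow (c : ℝ) {a b : ℝ} (hab : a < b) :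
    ∀ᶠ D : ℕ in atTop, c * (D : ℝ) ^ a ≤ (D : ℝ) ^ b := by
  have h1 : Tendsto (fun x : ℝ => x ^ (b - a)) atTop atTop := tendsto_rpow_atTop (by linarith)
  have h2 : Tendsto (fun D : ℕ => (D : ℝ) ^ (b - a)) atTop atTop :=
    h1.comp tendsto_natCast_atTop_atTop
  filter_upwards [h2.eventually_ge_atTop c, eventually_gt_atTop 0] with D hD hD0
  have hDpos : (0 : ℝ) < D := by exact_mod_cast hD0
  calc c * (D : ℝ) ^ a ≤ (D : ℝ) ^ (b - a) * (D : ℝ) ^ a :=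
        mul_le_mul_of_nonneg_right hD (Real.rpow_nonneg hDpos.le _)
    _ = (D : ℝ) ^ b := by rw [← Real.rpow_add hDpos, sub_add_cancel]

/-- `c (log D) D^a ≤ D^b` for large `D`, when `a < b`. [folklore] -/
theorem eventually_log_mul_rpow_le_rpow (c : ℝ) {a b : ℝ} (hab : a < b) :
    ∀ᶠ D : ℕ in atTop, c * Real.log D * (D : ℝ) ^ a ≤ (D : ℝ) ^ b := by
  have hs : 0 < (b - a) / 2 := by linarith
  -- `log x ≤ x^s` eventually
  have h1 : ∀ᶠ x : ℝ in atTop, Real.log x ≤ x ^ ((b - a) / 2) := by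
    have hlo := (isLittleO_log_rpow_atTop hs).bound one_pos
    filter_upwards [hlo, eventually_ge_atTop 1] with x hx hx1
    have h := (Real.le_norm_self _).trans hx
    rw [one_mul, Real.norm_of_nonneg (Real.rpow_nonneg (by linarith) _)] at h
    exact h
  have h1' : ∀ᶠ D : ℕ in atTop, Real.log D ≤ (D : ℝ) ^ ((b - a) / 2) :=
    tendsto_natCast_atTop_atTop.eventually h1
  have h2 := eventually_const_mul_rpow_le_rpow c (show a + (b - a) / 2 < b by linarith)
  filter_upwards [h1', h2, eventually_gt_atTop 0] with D hD1 hD2 hD0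
  have hDpos : (0 : ℝ) < D := by exact_mod_cast hD0
  rcases le_or_gt c 0 with hc | hc
  · have : c * Real.log D * (D : ℝ) ^ a ≤ 0 := by
      have hlog : 0 ≤ Real.log D := Real.log_nonneg (by exact_mod_cast hD0)
      have : c * Real.log D ≤ 0 := mul_nonpos_of_nonpos_of_nonneg hc hlog
      exact mul_nonpos_of_nonpos_of_nonneg this (Real.rpow_nonneg hDpos.le _)
    exact this.trans (Real.rpow_nonneg hDpos.le _)
  · calc c * Real.log D * (D : ℝ) ^ a ≤ c * (D : ℝ) ^ ((b - a) / 2) * (D : ℝ) ^ a := by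
          gcongr
      _ = c * (D : ℝ) ^ (a + (b - a) / 2) := by
          rw [Real.rpow_add hDpos, mul_assoc, mul_comm ((D : ℝ) ^ a)]
      _ ≤ (D : ℝ) ^ b := hD2

/-- `c (log D)² D^a ≤ D^b` for large `D`, when `a < b`. [folklore] -/
theorem eventually_log_sq_mul_rpow_le_rpow (c : ℝ) {a b : ℝ} (hab : a < b) :
    ∀ᶠ D : ℕ in atTop, c * Real.log D ^ 2 * (D : ℝ) ^ a ≤ (D : ℝ) ^ b := by
  have hs : 0 < (b - a) / 2 := by linarith
  have h1 : ∀ᶠ x : ℝ in atTop, Real.log x ^ 2 ≤ x ^ ((b - a) / 2) := by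
    have hlo := (isLittleO_log_rpow_rpow_atTop 2 hs).bound one_pos
    filter_upwards [hlo, eventually_ge_atTop 1] with x hx hx1
    have h := (Real.le_norm_self _).trans hx
    rw [one_mul, Real.norm_of_nonneg (Real.rpow_nonneg (by linarith) _), Real.rpow_two] at h
    exact h
  have h1' : ∀ᶠ D : ℕ in atTop, Real.log D ^ 2 ≤ (D : ℝ) ^ ((b - a) / 2) :=
    tendsto_natCast_atTop_atTop.eventually h1
  have h2 := eventually_const_mul_rpow_le_rpow c (show a + (b - a) / 2 < b by linarith)
  filter_upwards [h1', h2, eventually_gt_atTop 0] with D hD1 hD2 hD0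
  have hDpos : (0 : ℝ) < D := by exact_mod_cast hD0
  rcases le_or_gt c 0 with hc | hc
  · have : c * Real.log D ^ 2 * (D : ℝ) ^ a ≤ 0 :=
      mul_nonpos_of_nonpos_of_nonneg (mul_nonpos_of_nonpos_of_nonneg hc (sq_nonneg _))
        (Real.rpow_nonneg hDpos.le _)
    exact this.trans (Real.rpow_nonneg hDpos.le _)
  · calc c * Real.log D ^ 2 * (D : ℝ) ^ a ≤ c * (D : ℝ) ^ ((b - a) / 2) * (D : ℝ) ^ a := by
          gcongr
      _ = c * (D : ℝ) ^ (a + (b - a) / 2) := by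
          rw [Real.rpow_add hDpos, mul_assoc, mul_comm ((D : ℝ) ^ a)]
      _ ≤ (D : ℝ) ^ b := hD2

/-! ### The integer `T = ⌊D^τ⌋` -/

/-- `T ≤ D^τ`. [folklore] -/
theorem natFloor_rpow_le (D : ℕ) (τ : ℝ) : (⌊(D : ℝ) ^ τ⌋₊ : ℝ) ≤ (D : ℝ) ^ τ :=
  Nat.floor_le (Real.rpow_nonneg (Nat.cast_nonneg D) τ)

/-- `1 ≤ T` as soon as `D ≥ 1` (`τ ≥ 0`). [folklore] -/
theorem one_le_natFloor_rpow {D : ℕ} (hD : 1 ≤ D) {τ : ℝ} (hτ : 0 ≤ τ) : 1 ≤ ⌊(D : ℝ) ^ τ⌋₊ := by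
  rw [Nat.one_le_floor_iff]
  exact Real.one_le_rpow (by exact_mod_cast hD) hτ

/-- `D^τ ≤ 2T` as soon as `D ≥ 1` (`τ ≥ 0`). [folklore] -/
theorem rpow_le_two_mul_natFloor {D : ℕ} (hD : 1 ≤ D) {τ : ℝ} (hτ : 0 ≤ τ) :
    (D : ℝ) ^ τ ≤ 2 * ⌊(D : ℝ) ^ τ⌋₊ := by
  have h1 : (D : ℝ) ^ τ < ⌊(D : ℝ) ^ τ⌋₊ + 1 := Nat.lt_floor_add_one _
  have h2 : (1 : ℝ) ≤ ⌊(D : ℝ) ^ τ⌋₊ := by exact_mod_cast one_le_natFloor_rpow hD hτ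
  linarith

/-- `T → ∞` with `D` (`τ > 0`). [folklore] -/
theorem tendsto_natFloor_rpow_atTop {τ : ℝ} (hτ : 0 < τ) :
    Tendsto (fun D : ℕ => ⌊(D : ℝ) ^ τ⌋₊) atTop atTop := by
  have h : Tendsto (fun D : ℕ => (D : ℝ) ^ τ) atTop atTop :=
    (tendsto_rpow_atTop hτ).comp tendsto_natCast_atTop_atTop
  exact tendsto_nat_floor_atTop.comp h

/-- `c T ≤ binom(D+1, 2)` for large `D` (`τ < 2`). [cite: Roy2013, §7, Step 3 ("for `D` large enough, we also have `⌊(D*+1)^τ⌋ ≤ binom(D*+2, 2)`")] -/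
theorem eventually_mul_natFloor_rpow_le_choose (c : ℝ) {τ : ℝ} (hτ : τ < 2) :
    ∀ᶠ D : ℕ in atTop, c * ⌊(D : ℝ) ^ τ⌋₊ ≤ ((D + 1).choose 2 : ℕ) := by
  have h := eventually_const_mul_rpow_le_rpow (2 * max c 0) hτ
  filter_upwards [h, eventually_gt_atTop 0] with D hD hD0
  have hDpos : (0 : ℝ) < D := by exact_mod_cast hD0
  have hchoose : ((D + 1).choose 2 : ℕ) = ((D : ℝ) + 1) * D / 2 := by
    rw [Nat.choose_two_right, Nat.cast_div_charZero]
    · push_cast; ring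
    · simpa [Nat.succ_sub_one] using Nat.even_mul_pred_self (D + 1) |>.two_dvd
  have hT : (⌊(D : ℝ) ^ τ⌋₊ : ℝ) ≤ (D : ℝ) ^ τ := natFloor_rpow_le D τ
  have hsq : (D : ℝ) ^ (2 : ℝ) = (D : ℝ) * D := by rw [Real.rpow_two, sq]
  calc c * ⌊(D : ℝ) ^ τ⌋₊ ≤ max c 0 * ⌊(D : ℝ) ^ τ⌋₊ := by gcongr; exact le_max_left _ _
    _ ≤ max c 0 * (D : ℝ) ^ τ := by gcongr
    _ = (2 * max c 0 * (D : ℝ) ^ τ) / 2 := by ring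
    _ ≤ (D : ℝ) ^ (2 : ℝ) / 2 := by gcongr
    _ ≤ ((D : ℝ) + 1) * D / 2 := by rw [hsq]; gcongr; linarith
    _ = ((D + 1).choose 2 : ℕ) := hchoose.symm

/-- **The term `c T (log T)²` of Step 2 is eventually `≤ D^b` for any `b > τ`.**
[cite: Roy2013, §7, Step 2 ("if `D` is large enough (because `β > τ ≥ 1`)")] -/
theorem eventually_natFloor_log_sq_le (c : ℝ) {τ b : ℝ} (hτ0 : 0 ≤ τ) (hτ : τ < b) :
    ∀ᶠ D : ℕ in atTop, c * ⌊(D : ℝ) ^ τ⌋₊ * Real.log ⌊(D : ℝ) ^ τ⌋₊ ^ 2 ≤ (D : ℝ) ^ b := by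
  -- `(log T)² ≤ (τ log D)² ≤ ...`: we bound `log T ≤ log D^τ = τ log D` and use the previous lemma
  have h := eventually_log_sq_mul_rpow_le_rpow (max c 0 * τ ^ 2) hτ
  filter_upwards [h, eventually_ge_atTop 1] with D hD hD1
  have hDpos : (0 : ℝ) < D := by exact_mod_cast hD1
  have hT1 : (1 : ℝ) ≤ ⌊(D : ℝ) ^ τ⌋₊ := by exact_mod_cast one_le_natFloor_rpow hD1 hτ0
  have hTle : (⌊(D : ℝ) ^ τ⌋₊ : ℝ) ≤ (D : ℝ) ^ τ := natFloor_rpow_le D τ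
  have hlogT : Real.log ⌊(D : ℝ) ^ τ⌋₊ ≤ τ * Real.log D := by
    rw [← Real.log_rpow hDpos]
    exact Real.log_le_log (by linarith) hTle
  have hlogT0 : 0 ≤ Real.log ⌊(D : ℝ) ^ τ⌋₊ := Real.log_nonneg hT1
  calc c * ⌊(D : ℝ) ^ τ⌋₊ * Real.log ⌊(D : ℝ) ^ τ⌋₊ ^ 2
        ≤ max c 0 * ⌊(D : ℝ) ^ τ⌋₊ * Real.log ⌊(D : ℝ) ^ τ⌋₊ ^ 2 := by
          gcongr; exact le_max_left _ _
    _ ≤ max c 0 * (D : ℝ) ^ τ * (τ * Real.log D) ^ 2 := by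
          gcongr
    _ = max c 0 * τ ^ 2 * Real.log D ^ 2 * (D : ℝ) ^ τ := by ring
    _ ≤ (D : ℝ) ^ b := hD

end Roy2013

end Literature.NumberTheory.Transcendental
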